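import Summits.CriticalPhenomena.PercolationContinuityZ3.Theorems.PercNearOneGluingNoHeavyLowerTailMajorityGluingTypeTableScaledStar
import HarnessLib

/-!
# Template S in the kernel: the STAR-B chain for the scaled law (law-level real analysis)
(lane prim-rate, constants-miner 1, gen 30; census/g25/DERIVATIONS.md B5; RIGOROUS-CERTIFICATION.md §4)

Support file for the closed crux `NoHeavyLowerTail` (stmt-CriticalPhenomena-4575), majority-gluing line; continuation of
`…TypeTableScaledStar`.  For a law of a case with dominant relay `w`, upper band edge `r_hi(w) = h` and a relay `z ≠ w` with an
admissible code `t` (`θ = 2^{-t} ≤ max(θ_w, θ_z)`): `theta_TzTw` (`θ·T_z·T_w ≤ U₄` from STAR_w or STAR_z), `iso4_regroup` (ISO₄ +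
AM–GM on the three other relays), `scaled_star3` (the scaling step with the identity `s₀(2c₄−4) = 4−c₄`), and
**`starB_scaled`: `θ^{c₄}·T̂_z^{2c₄−1} ≤ (2+h)·M_top^{4−c₄}·(Σ̂₃(w)/3)^3`** for the scaled law.  No percolation, no sorries.
[cite: VandenbergHaggstromKahn2005, Thm. 1.3 (p. 6)]
-/

namespace Summit.CriticalPhenomena.PercolationContinuityZ3.Theorems

namespace HubOnly
namespace TypeTable

open DType

noncomputable section

variable {K : ℕ} {M : ℝ} {x : DType → ℝ} {cs : SCase}

/-- The analogous scaling step for the STAR-B shape: from `θ^c·T^{2c−1} ≤ M^{4−c}·W·s³` to the scaled law at `M_top`. -/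
theorem scaled_star3 (L : SLaw K cs M x) {θ T s W : ℝ} (hθ : 0 ≤ θ) (hT : 0 < T) (hs : 0 ≤ s) (hW : 0 ≤ W)
    (h : θ ^ ((3 + Real.sqrt (11 / 3)) / 2) * T ^ (2 * ((3 + Real.sqrt (11 / 3)) / 2) - 1) ≤
      M ^ (4 - (3 + Real.sqrt (11 / 3)) / 2) * W * s ^ (3 : ℕ)) :
    θ ^ ((3 + Real.sqrt (11 / 3)) / 2) * (scal K M * T) ^ (2 * ((3 + Real.sqrt (11 / 3)) / 2) - 1) ≤
      Mtop K ^ (4 - (3 + Real.sqrt (11 / 3)) / 2) * W * (scal K M * s) ^ (3 : ℕ) := by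
  set c := (3 + Real.sqrt (11 / 3)) / 2 with hcdef
  set b := 4 - c with hbdef
  obtain ⟨hl1, -, hLpos⟩ := scal_facts (K := K) L.Mpos L.Mle
  have hlampos : 0 < Mtop K / M := lt_of_lt_of_le zero_lt_one hl1
  have hL : scal K M = (Mtop K / M) ^ s0 := rfl
  have hc2 : 2 < c := ConvexBootstrap.two_lt_c4
  have hθc : 0 ≤ θ ^ c := Real.rpow_nonneg hθ _
  have e2 : θ ^ c * (scal K M * T) ^ (2 * c - 1) = (Mtop K / M) ^ (s0 * (2 * c - 1)) * (θ ^ c * T ^ (2 * c - 1)) := by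
    rw [Real.mul_rpow hLpos.le hT.le, hL, ← Real.rpow_mul hlampos.le]; ring
  have e3 : Mtop K ^ b * W * (scal K M * s) ^ (3 : ℕ) = (Mtop K / M) ^ (3 * s0 + b) * (M ^ b * W * s ^ (3 : ℕ)) := by
    have eM : Mtop K ^ b = (Mtop K / M) ^ b * M ^ b := by
      rw [← Real.mul_rpow hlampos.le L.Mpos.le, div_mul_cancel₀ _ (ne_of_gt L.Mpos)]
    rw [eM, hL, mul_pow, ← Real.rpow_natCast ((Mtop K / M) ^ s0), ← Real.rpow_mul hlampos.le,
      show 3 * s0 + b = s0 * ((3 : ℕ) : ℝ) + b by push_cast; ring, Real.rpow_add hlampos]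
    ring
  have step1 : (Mtop K / M) ^ (s0 * (2 * c - 1)) * (θ ^ c * T ^ (2 * c - 1)) ≤
      (Mtop K / M) ^ (s0 * (2 * c - 1)) * (M ^ b * W * s ^ (3 : ℕ)) :=
    mul_le_mul_of_nonneg_left h (Real.rpow_nonneg hlampos.le _)
  have hexp : s0 * (2 * c - 1) ≤ 3 * s0 + b := by
    have := s0_identity; rw [← hcdef] at this; rw [hbdef]; nlinarith
  have step2 : (Mtop K / M) ^ (s0 * (2 * c - 1)) ≤ (Mtop K / M) ^ (3 * s0 + b) :=
    Real.rpow_le_rpow_of_exponent_le hl1 hexp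
  have hP0 : 0 ≤ M ^ b * W * s ^ (3 : ℕ) := mul_nonneg (mul_nonneg (Real.rpow_nonneg L.Mpos.le _) hW) (pow_nonneg hs _)
  rw [e2, e3]
  exact step1.trans (mul_le_mul_of_nonneg_right step2 hP0)

/-! ### The STAR-B chain -/

/-- `Σ₃(w) = Σ₄ − (S_w + T_w)` typewise. -/
theorem sig3_combo : ∀ τ ∈ allTypes, ∀ w ∈ [1, 2, 3, 4], sig3φ w τ = sig4φ τ - stφ w τ := by decide +kernel

/-- `lin (Σ₃(w)) x = Σ_{y ≠ w} (S_y + T_y)`, written as `Σ₄ − (S_w + T_w)`. -/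
theorem lin_sig3 (x : DType → ℝ) {w : ℕ} (hw : w ∈ [1, 2, 3, 4]) :
    lin (sig3φ w) x = lin sig4φ x - (Sm w x + Tm w x) := by
  have e : lin (sig3φ w) x = lin (combo [(1, sig4φ), (-1, stφ w)]) x :=
    lin_congr (fun τ hτ => by
      simp only [combo, List.map_cons, List.map_nil, List.sum_cons, List.sum_nil, add_zero, one_mul, neg_one_mul]
      rw [sig3_combo τ hτ w hw]; ring) x
  have e2 : lin (stφ w) x = Sm w x + Tm w x := by
    have h := lin_combo [(1, fun τ => ind (τ.isS w)), (1, fun τ => ind (τ.isT w))] x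
    simp only [List.map_cons, List.map_nil, List.sum_cons, List.sum_nil, add_zero, Int.cast_one, one_mul] at h
    rw [← h]; exact lin_congr (fun τ _ => by simp [combo, stφ]) x
  rw [e, lin_combo]; simp only [List.map_cons, List.map_nil, List.sum_cons, List.sum_nil]; push_cast; rw [e2]; ring

/-- `a·b·c ≤ ((a+b+c)/3)^3` for nonnegative reals (AM–GM). -/
theorem amgm3 {a b c : ℝ} (ha : 0 ≤ a) (hb : 0 ≤ b) (hc : 0 ≤ c) : a * b * c ≤ ((a + b + c) / 3) ^ 3 := by
  nlinarith [mul_nonneg (mul_nonneg ha hb) hc, mul_nonneg ha (sq_nonneg (b - c)), mul_nonneg hb (sq_nonneg (c - a)),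
    mul_nonneg hc (sq_nonneg (a - b)), mul_nonneg (add_nonneg (add_nonneg ha hb) hc) (sq_nonneg (a - b)),
    mul_nonneg (add_nonneg (add_nonneg ha hb) hc) (sq_nonneg (b - c)),
    mul_nonneg (add_nonneg (add_nonneg ha hb) hc) (sq_nonneg (c - a))]

/-- ISO₄ regrouped around a relay `w`: `U₄^{c₄} ≤ M^{4−c₄}·(S_w+T_w)·((Σ₃(w))/3)^3` (AM–GM on the other three). -/
theorem iso4_regroup (L : SLaw K cs M x) {w : ℕ} (hw : w ∈ [1, 2, 3, 4]) :
    uS [1, 2, 3, 4] x ^ ((3 + Real.sqrt (11 / 3)) / 2) ≤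
      M ^ (4 - (3 + Real.sqrt (11 / 3)) / 2) * (Sm w x + Tm w x) * (lin (sig3φ w) x / 3) ^ (3 : ℕ) := by
  have hx := L.nonneg
  have h := L.iso4
  have hK : 0 ≤ M ^ (4 - (3 + Real.sqrt (11 / 3)) / 2) := Real.rpow_nonneg L.Mpos.le _
  have s1 : 0 ≤ Sm 1 x + Tm 1 x := add_nonneg (lin_ind_nonneg _ hx) (lin_ind_nonneg _ hx)
  have s2 : 0 ≤ Sm 2 x + Tm 2 x := add_nonneg (lin_ind_nonneg _ hx) (lin_ind_nonneg _ hx)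
  have s3 : 0 ≤ Sm 3 x + Tm 3 x := add_nonneg (lin_ind_nonneg _ hx) (lin_ind_nonneg _ hx)
  have s4 : 0 ≤ Sm 4 x + Tm 4 x := add_nonneg (lin_ind_nonneg _ hx) (lin_ind_nonneg _ hx)
  rw [lin_sig3 x hw, lin_sig4]
  simp only [List.mem_cons, List.not_mem_nil, or_false] at hw
  rcases hw with rfl | rfl | rfl | rfl
  · have ha := amgm3 s2 s3 s4
    calc _ ≤ M ^ (4 - (3 + Real.sqrt (11 / 3)) / 2) * (Sm 1 x + Tm 1 x) * ((Sm 2 x + Tm 2 x) * (Sm 3 x + Tm 3 x) * (Sm 4 x + Tm 4 x)) := by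
          linarith [h]
      _ ≤ M ^ (4 - (3 + Real.sqrt (11 / 3)) / 2) * (Sm 1 x + Tm 1 x) * (((Sm 2 x + Tm 2 x) + (Sm 3 x + Tm 3 x) + (Sm 4 x + Tm 4 x)) / 3) ^ 3 :=
          mul_le_mul_of_nonneg_left ha (mul_nonneg hK s1)
      _ = _ := by ring
  · have ha := amgm3 s1 s3 s4
    calc _ ≤ M ^ (4 - (3 + Real.sqrt (11 / 3)) / 2) * (Sm 2 x + Tm 2 x) * ((Sm 1 x + Tm 1 x) * (Sm 3 x + Tm 3 x) * (Sm 4 x + Tm 4 x)) := by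
          linarith [h]
      _ ≤ M ^ (4 - (3 + Real.sqrt (11 / 3)) / 2) * (Sm 2 x + Tm 2 x) * (((Sm 1 x + Tm 1 x) + (Sm 3 x + Tm 3 x) + (Sm 4 x + Tm 4 x)) / 3) ^ 3 :=
          mul_le_mul_of_nonneg_left ha (mul_nonneg hK s2)
      _ = _ := by ring
  · have ha := amgm3 s1 s2 s4
    calc _ ≤ M ^ (4 - (3 + Real.sqrt (11 / 3)) / 2) * (Sm 3 x + Tm 3 x) * ((Sm 1 x + Tm 1 x) * (Sm 2 x + Tm 2 x) * (Sm 4 x + Tm 4 x)) := by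
          linarith [h]
      _ ≤ M ^ (4 - (3 + Real.sqrt (11 / 3)) / 2) * (Sm 3 x + Tm 3 x) * (((Sm 1 x + Tm 1 x) + (Sm 2 x + Tm 2 x) + (Sm 4 x + Tm 4 x)) / 3) ^ 3 :=
          mul_le_mul_of_nonneg_left ha (mul_nonneg hK s3)
      _ = _ := by ring
  · have ha := amgm3 s1 s2 s3
    calc _ ≤ M ^ (4 - (3 + Real.sqrt (11 / 3)) / 2) * (Sm 4 x + Tm 4 x) * ((Sm 1 x + Tm 1 x) * (Sm 2 x + Tm 2 x) * (Sm 3 x + Tm 3 x)) := by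
          linarith [h]
      _ ≤ M ^ (4 - (3 + Real.sqrt (11 / 3)) / 2) * (Sm 4 x + Tm 4 x) * (((Sm 1 x + Tm 1 x) + (Sm 2 x + Tm 2 x) + (Sm 3 x + Tm 3 x)) / 3) ^ 3 :=
          mul_le_mul_of_nonneg_left ha (mul_nonneg hK s4)
      _ = _ := by ring

/-- `θ·T_z·T_w ≤ U₄` from STAR_w or STAR_z (whichever relay the code `t` is admissible for). -/
theorem theta_TzTw (L : SLaw K cs M x) {z : ℕ} (hz : z ∈ [1, 2, 3, 4]) (hzw : z ≠ cs.w) {t : ℕ}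
    (ht : tcodeLE (cs.bandOf z).tcode t = true ∨ tcodeLE (cs.bandOf cs.w).tcode t = true) :
    ((1 : ℝ) / 2) ^ t * Tm z x * Tm cs.w x ≤ uS [1, 2, 3, 4] x := by
  have hw := L.wmem
  have hθ : 0 ≤ ((1 : ℝ) / 2) ^ t := by positivity
  have hTz := (L.Tpos z hz).le
  have hTw := (L.Tpos cs.w hw).le
  rcases ht with ht | ht
  · have h1 := starθ L hz hθ (theta_of_code L hz ht)
    have hoth := Tw_le_others L hz hzw
    calc ((1 : ℝ) / 2) ^ t * Tm z x * Tm cs.w x = ((1 : ℝ) / 2) ^ t * (Tm z x * Tm cs.w x) := by ring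
      _ ≤ ((1 : ℝ) / 2) ^ t * (Tm z x * (Tm 1 x + Tm 2 x + Tm 3 x + Tm 4 x - Tm z x)) :=
          mul_le_mul_of_nonneg_left (mul_le_mul_of_nonneg_left hoth hTz) hθ
      _ ≤ _ := h1
  · have h1 := starθ L hw hθ (theta_of_code L hw ht)
    have hoth := T_le_others L hz hw hzw
    calc ((1 : ℝ) / 2) ^ t * Tm z x * Tm cs.w x = ((1 : ℝ) / 2) ^ t * (Tm cs.w x * Tm z x) := by ring
      _ ≤ ((1 : ℝ) / 2) ^ t * (Tm cs.w x * (Tm 1 x + Tm 2 x + Tm 3 x + Tm 4 x - Tm cs.w x)) :=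
          mul_le_mul_of_nonneg_left (mul_le_mul_of_nonneg_left hoth hTw) hθ
      _ ≤ _ := h1

/-- **STAR-B for the scaled law.**  For a non-dominant relay `z`, the dominant relay's upper band edge `r_hi(w) = h` and an
admissible code `t` (`θ = 2^{-t} ≤ max(θ_w, θ_z)`):
`θ^{c₄}·T̂_z^{2c₄−1} ≤ M_top^{4−c₄}·(2+h)·(Σ̂₃(w)/3)^3`. -/
theorem starB_scaled (L : SLaw K cs M x) {z : ℕ} (hz : z ∈ [1, 2, 3, 4]) (hzw : z ≠ cs.w) {h : ℚ}
    (hh : (cs.bandOf cs.w).hi = some h) {t : ℕ}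
    (ht : tcodeLE (cs.bandOf z).tcode t = true ∨ tcodeLE (cs.bandOf cs.w).tcode t = true) :
    (((1 : ℝ) / 2) ^ t) ^ ((3 + Real.sqrt (11 / 3)) / 2) *
        (Tm z (xs false K M cs.w x)) ^ (2 * ((3 + Real.sqrt (11 / 3)) / 2) - 1) ≤
      Mtop K ^ (4 - (3 + Real.sqrt (11 / 3)) / 2) * (2 + (h : ℝ)) * (lin (sig3φ cs.w) (xs false K M cs.w x) / 3) ^ (3 : ℕ) := by
  have hx := L.nonneg
  have hw := L.wmem
  set c := (3 + Real.sqrt (11 / 3)) / 2 with hcdef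
  set θ : ℝ := ((1 : ℝ) / 2) ^ t with hθdef
  have hθ : 0 ≤ θ := by positivity
  have hc2 : 2 < c := ConvexBootstrap.two_lt_c4
  have hTz := L.Tpos z hz
  have hTw := L.Tpos cs.w hw
  have hzw' := L.dom z hz
  have hK : 0 ≤ M ^ (4 - c) := Real.rpow_nonneg L.Mpos.le _
  -- B1, B2
  have b1 := theta_TzTw L hz hzw ht
  have b2 := iso4_regroup L hw
  have hband := L.bandHi cs.w hw h hh
  have hs3 : 0 ≤ lin (sig3φ cs.w) x / 3 := div_nonneg (sig_nonneg hx hw).2 (by norm_num)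
  set s := lin (sig3φ cs.w) x / 3 with hsdef
  have hSw : Sm cs.w x + Tm cs.w x ≤ (2 + (h : ℝ)) * Tm cs.w x := by linarith
  have b2' : uS [1, 2, 3, 4] x ^ c ≤ M ^ (4 - c) * ((2 + (h : ℝ)) * Tm cs.w x) * s ^ (3 : ℕ) := by
    refine b2.trans ?_
    have := mul_le_mul_of_nonneg_left hSw hK
    exact mul_le_mul_of_nonneg_right this (pow_nonneg hs3 _)
  -- B3: (θ T_z T_w)^c ≤ ..., cancel T_w, use T_z ≤ T_w
  have hprod : 0 ≤ θ * Tm z x * Tm cs.w x := by positivity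
  have b3 : (θ * Tm z x * Tm cs.w x) ^ c ≤ M ^ (4 - c) * ((2 + (h : ℝ)) * Tm cs.w x) * s ^ (3 : ℕ) :=
    (Real.rpow_le_rpow hprod b1 (by linarith)).trans b2'
  have e1 : (θ * Tm z x * Tm cs.w x) ^ c = θ ^ c * Tm z x ^ c * (Tm cs.w x ^ (c - 1) * Tm cs.w x) := by
    rw [Real.mul_rpow (mul_nonneg hθ hTz.le) hTw.le, Real.mul_rpow hθ hTz.le]
    congr 1
    rw [show Tm cs.w x ^ c = Tm cs.w x ^ ((c - 1) + 1) by ring_nf, Real.rpow_add hTw, Real.rpow_one]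
  rw [e1] at b3
  have b4 : θ ^ c * Tm z x ^ c * Tm cs.w x ^ (c - 1) ≤ M ^ (4 - c) * (2 + (h : ℝ)) * s ^ (3 : ℕ) := by
    have : (θ ^ c * Tm z x ^ c * Tm cs.w x ^ (c - 1)) * Tm cs.w x ≤ (M ^ (4 - c) * (2 + (h : ℝ)) * s ^ (3 : ℕ)) * Tm cs.w x := by
      calc _ = θ ^ c * Tm z x ^ c * (Tm cs.w x ^ (c - 1) * Tm cs.w x) := by ring
        _ ≤ _ := b3
        _ = _ := by ring
    exact le_of_mul_le_mul_right this hTw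
  have hzc : Tm z x ^ (c - 1) ≤ Tm cs.w x ^ (c - 1) := Real.rpow_le_rpow hTz.le hzw' (by linarith)
  have b5 : θ ^ c * Tm z x ^ c * Tm z x ^ (c - 1) ≤ M ^ (4 - c) * (2 + (h : ℝ)) * s ^ (3 : ℕ) := by
    have h0 : 0 ≤ θ ^ c * Tm z x ^ c := mul_nonneg (Real.rpow_nonneg hθ _) (Real.rpow_nonneg hTz.le _)
    exact (mul_le_mul_of_nonneg_left hzc h0).trans b4
  have e2 : θ ^ c * Tm z x ^ c * Tm z x ^ (c - 1) = θ ^ c * Tm z x ^ (2 * c - 1) := by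
    rw [mul_assoc, ← Real.rpow_add hTz]; ring_nf
  rw [e2] at b5
  -- B4: scaling
  have h2 : 0 ≤ (2 + (h : ℝ)) := by
    have := hSw; have hS0 : 0 ≤ Sm cs.w x := lin_ind_nonneg _ hx; nlinarith
  have b6 := scaled_star3 L hθ hTz hs3 h2 b5
  have eT : Tm z (xs false K M cs.w x) = scal K M * Tm z x := lin_xs _ _
  have eS : lin (sig3φ cs.w) (xs false K M cs.w x) / 3 = scal K M * s := by rw [lin_xs, hsdef]; ring
  rw [eT, eS]
  exact b6

end

end TypeTable
end HubOnly

end Summit.CriticalPhenomena.PercolationContinuityZ3.Theorems
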